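import Literature.Probability.RandomPlanarGeometry.SAWBendingEnergy
import Mathlib.Analysis.SpecialFunctions.Pow.Real
import HarnessLib

/-!
# Partially directed walks bound the bending free energy from below: `κ(t) ≥ log(1 + √2 t)`

Topic `Literature/Probability/RandomPlanarGeometry` (continues `SAWBendingEnergy.lean`: `Zd.Zbend`, `Zd.bendFE`, `wturns`,
`Zbend_eq_sum_sawWords`).

Source: partially directed self-avoiding walks (steps `+e₀, ±e₁`, no immediate vertical reversal) are a classical exactly
solvable sub-family (Madras–Slade 1993, §2.1); here they are counted BY TURNS with the two-state transfer recursion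
`H' = H + t(V₊ + V₋)`, `V±' = tH + V±` (`H`, `V±` = turn-weighted counts by last… here FIRST letter), whose Perron
eigenvalue is `1 + √2 t` with eigenvector `(1, √2)` split as `(1, 1/√2, 1/√2)`… we only use the resulting inequalities
`H_n ≥ (1+√2t)^n`, `V_n ≥ √2 (1+√2t)^n`.

## Contents (namespace `Literature.Probability.RandomPlanarGeometry.SAW`; all proved, standard axioms)

* `PDAdm`, `IsPD` (partially directed words), `IsPD.isSAW` (they are self-avoiding: first coordinate nondecreasing, and a
  point with first coordinate `0` at time `k` is `k·e_a`);
* `pdW`, `pdT` (turn-weighted counts by head letter), `pdT_succ` (transfer recursion), `pdT_lower` (eigenvector bound),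
  `sum_pdT_le_Zbend`, **`one_add_sqrt_two_mul_pow_le_Zbend`**: `(1 + √2)(1 + √2 t)^n ≤ Z_{n+1}(t)` (`t ≥ 0`);
* the planner's Props VERBATIM (`Sketch_v7_add1.lean` a62b149f2f7a9f12 / `Sketch_v7.lean` d87c31580ac19fbc):
  `Zd.Zbend_lower_sqrt2`, `Zd.BendFE_lower_sqrt2`, `Zd.StiffLimit_lower ρlo`, with proofs
  **`Zd.Zbend_lower_sqrt2_holds`**, **`Zd.BendFE_lower_sqrt2_holds`** (`log(1+√2t) ≤ κ(t)` for every `t > 0`: every term of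
  the infimum is bounded, since `(1+√2)·max(1,t) ≥ 1 + √2 t` — no Fekete limit is needed) and
  **`Zd.StiffLimit_lower_inv_sqrt_two : StiffLimit_lower (1 / Real.sqrt 2)`** (`(√2 - δ)t ≤ κ(t)` for small `t > 0`).

Printed status: the lower bound `liminf_{t→0} κ(t)/t ≥ √2` with this explicit all-`t` form is the lane's (route
«STIFF» S4); the partially directed family itself is classical.
-/

noncomputable section

open Finset Filter Topology
open scoped BigOperators
open Literature.Probability.LatticeModels

namespace Literature.Probability.RandomPlanarGeometry.SAW

/-! ### Partially directed words: no West step, no vertical reversal -/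

/-- Admissible consecutive letters of a partially directed word: the second letter is not `-e₀`, and a vertical
step is never followed by its reversal. [cite: MadrasSlade1993, §2.1] -/
def PDAdm (a b : Step) : Prop := b ≠ 2 ∧ ¬(a = 1 ∧ b = 3) ∧ ¬(a = 3 ∧ b = 1)

/-- `PDAdm` is decidable. [cite: MadrasSlade1993, §1.1] -/
instance (a b : Step) : Decidable (PDAdm a b) := inferInstanceAs (Decidable (_ ∧ _ ∧ _))

/-- **Partially directed words** (letters `+e₀, ±e₁`; no immediate vertical reversal). [cite: MadrasSlade1993, §2.1] -/
def IsPD : List Step → Prop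
  | [] => True
  | [a] => a ≠ 2
  | a :: b :: w => a ≠ 2 ∧ PDAdm a b ∧ IsPD (b :: w)

/-- `IsPD` is decidable. [cite: MadrasSlade1993, §1.1] -/
instance instDecidableIsPD : ∀ w : List Step, Decidable (IsPD w)
  | [] => isTrue trivial
  | [a] => inferInstanceAs (Decidable (a ≠ 2))
  | a :: b :: w =>
    haveI : Decidable (IsPD (b :: w)) := instDecidableIsPD (b :: w)
    inferInstanceAs (Decidable (a ≠ 2 ∧ PDAdm a b ∧ IsPD (b :: w)))

/-- Unfolding `IsPD` on `a :: b :: w`. [cite: MadrasSlade1993, §1.1] -/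
@[simp] theorem isPD_cons_cons (a b : Step) (w : List Step) :
    IsPD (a :: b :: w) ↔ a ≠ 2 ∧ PDAdm a b ∧ IsPD (b :: w) := Iff.rfl

/-- Unfolding `IsPD` on a singleton. [cite: MadrasSlade1993, §1.1] -/
@[simp] theorem isPD_singleton (a : Step) : IsPD [a] ↔ a ≠ 2 := Iff.rfl

/-- The head of a nonempty partially directed word is not `-e₀`. [cite: MadrasSlade1993, §1.1] -/
theorem IsPD.head_ne_two {a : Step} {v : List Step} (h : IsPD (a :: v)) : a ≠ 2 := by
  cases v with
  | nil => exact h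
  | cons b w => exact h.1

/-- The tail of a partially directed word is partially directed. [cite: MadrasSlade1993, §1.1] -/
theorem IsPD.tail {a : Step} {v : List Step} (h : IsPD (a :: v)) : IsPD v := by
  cases v with
  | nil => trivial
  | cons b w => exact h.2.2

/-- A letter other than `-e₀` has nonnegative first coordinate. [cite: MadrasSlade1993, §1.1] -/
theorem Step.dx_nonneg_of_ne_two {a : Step} (h : a ≠ 2) : 0 ≤ Step.dx a := by
  fin_cases a <;> simp [Step.dx] at h ⊢

/-- A letter other than `-e₀` with vanishing first coordinate is vertical, hence has `dy ≠ 0`. [cite: MadrasSlade1993, §1.1] -/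
theorem Step.dy_ne_zero_of_dx_eq_zero {a : Step} (h : a ≠ 2) (hx : Step.dx a = 0) : Step.dy a ≠ 0 := by
  fin_cases a <;> simp [Step.dx, Step.dy] at h hx ⊢

/-- Two admissible consecutive VERTICAL letters are equal. [cite: MadrasSlade1993, §1.1] -/
theorem PDAdm.eq_of_vertical {a b : Step} (h : PDAdm a b) (ha : a ≠ 2) (hxa : Step.dx a = 0) (hxb : Step.dx b = 0) :
    a = b := by
  obtain ⟨hb, h1, h2⟩ := h
  fin_cases a <;> fin_cases b <;> simp [Step.dx] at ha hb h1 h2 hxa hxb ⊢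

/-- Geometry of a partially directed word `a :: v`: every point has first coordinate `≥ 0`, and a point with first
coordinate `0` at time `k` is `k · e_a` (the walk has gone straight so far). [cite: MadrasSlade1993, §2.1] -/
theorem IsPD.traj_fst_nonneg {a : Step} {v : List Step} (h : IsPD (a :: v)) :
    ∀ k ≤ v.length + 1, 0 ≤ traj (a :: v) k 0 ∧ (traj (a :: v) k 0 = 0 → traj (a :: v) k = (k : ℤ) • Step.vec a) := by
  induction v generalizing a with
  | nil =>
    intro k hk
    simp only [List.length_nil, zero_add] at hk
    interval_cases k
    · simp
    · rw [traj_cons_one]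
      exact ⟨by simpa using Step.dx_nonneg_of_ne_two h, fun _ => by simp⟩
  | cons b w ih =>
    have hb : IsPD (b :: w) := h.tail
    have ha : a ≠ 2 := h.head_ne_two
    have hadm : PDAdm a b := h.2.1
    intro k hk
    rcases Nat.eq_zero_or_pos k with rfl | hkpos
    · simp
    · obtain ⟨k', rfl⟩ : ∃ k', k = k' + 1 := ⟨k - 1, by omega⟩
      rw [traj_cons_succ]
      obtain ⟨hx, hstraight⟩ := ih hb k' (by simpa using hk)
      have hxa := Step.dx_nonneg_of_ne_two ha
      refine ⟨by simpa using add_nonneg hxa hx, fun hzero => ?_⟩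
      have hzero' : Step.dx a + traj (b :: w) k' 0 = 0 := by simpa using hzero
      have hxa0 : Step.dx a = 0 := by linarith
      have hx0 : traj (b :: w) k' 0 = 0 := by linarith
      have hs := hstraight hx0
      rcases Nat.eq_zero_or_pos k' with rfl | hk'
      · simp
      · -- `b` is vertical too (its first coordinate contributes `k' · dx b = 0`), hence `b = a`
        have hxb : Step.dx b = 0 := by
          have e := congrFun hs 0
          rw [hx0] at e
          simp only [Pi.smul_apply, Step.vec_apply_zero, smul_eq_mul] at e
          have hk'0 : (k' : ℤ) ≠ 0 := by exact_mod_cast hk'.ne'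
          rcases mul_eq_zero.1 e.symm with h0 | h0
          · exact absurd h0 hk'0
          · exact h0
        have hab : a = b := hadm.eq_of_vertical ha hxa0 hxb
        subst hab
        rw [hs]
        push_cast
        rw [add_smul, one_smul, add_comm]

/-- A partially directed word never returns to its starting point. [cite: MadrasSlade1993, §2.1] -/
theorem IsPD.traj_ne_zero {a : Step} {v : List Step} (h : IsPD (a :: v)) {k : ℕ} (hk1 : 1 ≤ k)
    (hk : k ≤ v.length + 1) : traj (a :: v) k ≠ 0 := by
  intro hzero
  obtain ⟨-, hstraight⟩ := h.traj_fst_nonneg k hk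
  have hx0 : traj (a :: v) k 0 = 0 := by rw [hzero]; rfl
  have hs := hstraight hx0
  rw [hzero] at hs
  have ha := h.head_ne_two
  have e0 := congrFun hs 0
  have e1 := congrFun hs 1
  simp only [Pi.zero_apply, Pi.smul_apply, Step.vec_apply_zero, Step.vec_apply_one, smul_eq_mul] at e0 e1
  have hk0 : (k : ℤ) ≠ 0 := by exact_mod_cast (show k ≠ 0 by omega)
  have hxa : Step.dx a = 0 := by
    rcases mul_eq_zero.1 e0.symm with h0 | h0
    · exact absurd h0 hk0
    · exact h0
  have hya : Step.dy a = 0 := by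
    rcases mul_eq_zero.1 e1.symm with h0 | h0
    · exact absurd h0 hk0
    · exact h0
  exact Step.dy_ne_zero_of_dx_eq_zero ha hxa hya

/-- **Partially directed words are self-avoiding.** [cite: MadrasSlade1993, §2.1] -/
theorem IsPD.isSAW {w : List Step} (h : IsPD w) : IsSAW w := by
  induction w with
  | nil => exact isSAW_nil
  | cons a v ih =>
    have hv : IsSAW v := ih h.tail
    rw [isSAW_iff_injOn] at hv ⊢
    intro i hi j hj hij
    simp only [Set.mem_setOf_eq, List.length_cons] at hi hj
    rcases Nat.eq_zero_or_pos i with rfl | hi0 <;> rcases Nat.eq_zero_or_pos j with rfl | hj0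
    · rfl
    · exact absurd (hij.symm.trans (traj_zero _)) (h.traj_ne_zero hj0 hj)
    · exact absurd (hij.trans (traj_zero _)) (h.traj_ne_zero hi0 hi)
    · obtain ⟨i', rfl⟩ : ∃ i', i = i' + 1 := ⟨i - 1, by omega⟩
      obtain ⟨j', rfl⟩ : ∃ j', j = j' + 1 := ⟨j - 1, by omega⟩
      rw [traj_cons_succ, traj_cons_succ, add_right_inj] at hij
      have := hv (show i' ≤ v.length by omega) (show j' ≤ v.length by omega) hij
      omega

/-! ### Counting partially directed words by turns: the transfer recursion -/

/-- The turn weight of a word if it is partially directed, else `0`. [cite: MadrasSlade1993, §1.1] -/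
def pdW (t : ℝ) (w : List Step) : ℝ := if IsPD w then t ^ wturns w else 0

/-- `pdW ≥ 0` for `t ≥ 0`. [cite: MadrasSlade1993, §1.1] -/
theorem pdW_nonneg {t : ℝ} (ht : 0 ≤ t) (w : List Step) : 0 ≤ pdW t w := by
  unfold pdW; split_ifs <;> positivity

/-- The turn-weighted count of the partially directed words of length `n + 1` with prescribed head `a`.
[cite: MadrasSlade1993, §2.1] -/
def pdT (t : ℝ) (n : ℕ) (a : Step) : ℝ := ∑ g : Fin n → Step, pdW t (a :: List.ofFn g)

/-- Base case: a one-letter word. [cite: MadrasSlade1993, §1.1] -/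
theorem pdT_zero (t : ℝ) (a : Step) : pdT t 0 a = if a ≠ 2 then 1 else 0 := by
  simp [pdT, pdW]

/-- Splitting a sum over words of length `n + 1` by the first letter. [cite: MadrasSlade1993, §1.1] -/
theorem sum_fin_succ_eq {β : Type*} [AddCommMonoid β] (n : ℕ) (F : (Fin (n + 1) → Step) → β) :
    ∑ g : Fin (n + 1) → Step, F g = ∑ b : Step, ∑ g : Fin n → Step, F (Fin.cons b g) := by
  rw [← (Fin.consEquiv fun _ : Fin (n + 1) => Step).sum_comp F, Fintype.sum_prod_type]
  exact Finset.sum_congr rfl fun b _ => Finset.sum_congr rfl fun g _ => rfl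

/-- The transfer step for `pdW`. [cite: MadrasSlade1993, §1.1] -/
theorem pdW_cons_cons (t : ℝ) (a b : Step) (w : List Step) :
    pdW t (a :: b :: w) = (if a ≠ 2 ∧ PDAdm a b then t ^ (if a = b then 0 else 1) else 0) * pdW t (b :: w) := by
  unfold pdW
  by_cases h1 : a ≠ 2 ∧ PDAdm a b
  · by_cases h2 : IsPD (b :: w)
    · have h3 : IsPD (a :: b :: w) := ⟨h1.1, h1.2, h2⟩
      rw [if_pos h3, if_pos h1, if_pos h2, wturns_cons_cons, pow_add]
    · have h3 : ¬ IsPD (a :: b :: w) := fun h => h2 h.2.2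
      rw [if_neg h3, if_neg h2, mul_zero]
  · have h3 : ¬ IsPD (a :: b :: w) := fun h => h1 ⟨h.1, h.2.1⟩
    rw [if_neg h3, if_neg h1, zero_mul]

/-- **The transfer recursion**: `T_{n+1}(a) = Σ_b c(a,b) T_n(b)` with `c(a,b) = t^{[a ≠ b]}` for admissible `(a,b)`
and `0` otherwise. [cite: MadrasSlade1993, §2.1] -/
theorem pdT_succ (t : ℝ) (n : ℕ) (a : Step) :
    pdT t (n + 1) a = ∑ b : Step, (if a ≠ 2 ∧ PDAdm a b then t ^ (if a = b then 0 else 1) else 0) * pdT t n b := by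
  unfold pdT
  rw [sum_fin_succ_eq]
  refine Finset.sum_congr rfl fun b _ => ?_
  rw [Finset.mul_sum]
  refine Finset.sum_congr rfl fun g _ => ?_
  rw [List.ofFn_cons, pdW_cons_cons]

/-- The recursion, written out: `H' = H + t(V₊ + V₋)`. [cite: MadrasSlade1993, §1.1] -/
theorem pdT_succ_zero (t : ℝ) (n : ℕ) : pdT t (n + 1) 0 = pdT t n 0 + t * pdT t n 1 + t * pdT t n 3 := by
  rw [pdT_succ, Fin.sum_univ_four]
  simp [PDAdm]

/-- `V₊' = t H + V₊`. [cite: MadrasSlade1993, §1.1] -/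
theorem pdT_succ_one (t : ℝ) (n : ℕ) : pdT t (n + 1) 1 = t * pdT t n 0 + pdT t n 1 := by
  rw [pdT_succ, Fin.sum_univ_four]
  simp [PDAdm]

/-- `V₋' = t H + V₋`. [cite: MadrasSlade1993, §1.1] -/
theorem pdT_succ_three (t : ℝ) (n : ℕ) : pdT t (n + 1) 3 = t * pdT t n 0 + pdT t n 3 := by
  rw [pdT_succ, Fin.sum_univ_four]
  simp [PDAdm]

/-- **Perron–Frobenius lower bound for the transfer recursion**: `H_n ≥ (1+√2 t)^n` and
`V_n ≥ √2 (1+√2 t)^n` (the vector `(1, √2)` is an eigenvector for the eigenvalue `1 + √2 t`).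
[cite: MadrasSlade1993, §2.1] -/
theorem pdT_lower {t : ℝ} (ht : 0 ≤ t) (n : ℕ) :
    (1 + Real.sqrt 2 * t) ^ n ≤ pdT t n 0 ∧ Real.sqrt 2 * (1 + Real.sqrt 2 * t) ^ n ≤ pdT t n 1 + pdT t n 3 := by
  have hs2 : Real.sqrt 2 * Real.sqrt 2 = 2 := Real.mul_self_sqrt (by norm_num)
  have hs0 : 0 ≤ Real.sqrt 2 := Real.sqrt_nonneg 2
  have hs1 : Real.sqrt 2 ≤ 2 := by nlinarith
  induction n with
  | zero =>
    have h0 : (0 : Step) ≠ 2 := by decide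
    have h1 : (1 : Step) ≠ 2 := by decide
    have h3 : (3 : Step) ≠ 2 := by decide
    simp only [pow_zero, pdT_zero, mul_one, if_pos h0, if_pos h1, if_pos h3]
    exact ⟨le_rfl, by linarith⟩
  | succ n ih =>
    obtain ⟨hH, hV⟩ := ih
    rw [pdT_succ_zero, pdT_succ_one, pdT_succ_three]
    constructor
    · calc (1 + Real.sqrt 2 * t) ^ (n + 1) = (1 + Real.sqrt 2 * t) ^ n + t * (Real.sqrt 2 * (1 + Real.sqrt 2 * t) ^ n) := by
            ring
        _ ≤ pdT t n 0 + t * (pdT t n 1 + pdT t n 3) := add_le_add hH (mul_le_mul_of_nonneg_left hV ht)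
        _ = pdT t n 0 + t * pdT t n 1 + t * pdT t n 3 := by ring
    · calc Real.sqrt 2 * (1 + Real.sqrt 2 * t) ^ (n + 1)
          = 2 * t * (1 + Real.sqrt 2 * t) ^ n + Real.sqrt 2 * (1 + Real.sqrt 2 * t) ^ n := by
            rw [pow_succ]; linear_combination t * (1 + Real.sqrt 2 * t) ^ n * hs2
        _ ≤ 2 * t * pdT t n 0 + (pdT t n 1 + pdT t n 3) :=
            add_le_add (mul_le_mul_of_nonneg_left hH (by positivity)) hV
        _ = t * pdT t n 0 + pdT t n 1 + (t * pdT t n 0 + pdT t n 3) := by ring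

/-- The partially directed words are among the self-avoiding words, so their turn-weighted count is a lower bound
for `Z_{n+1}(t)`. [cite: MadrasSlade1993, §2.1] -/
theorem sum_pdT_le_Zbend {t : ℝ} (ht : 0 ≤ t) (n : ℕ) : ∑ a : Step, pdT t n a ≤ Zd.Zbend (n + 1) t := by
  classical
  -- Σ_a T_n(a) = Σ_{g : Fin (n+1) → Step} pdW (ofFn g) = Σ_{w ∈ words (n+1)} pdW w
  have h1 : ∑ a : Step, pdT t n a = ∑ g : Fin (n + 1) → Step, pdW t (List.ofFn g) := by
    rw [sum_fin_succ_eq]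
    refine Finset.sum_congr rfl fun a _ => Finset.sum_congr rfl fun g _ => ?_
    rw [List.ofFn_cons]
  have h2 : ∑ g : Fin (n + 1) → Step, pdW t (List.ofFn g) = ∑ w ∈ words (n + 1), pdW t w := by
    rw [words, Finset.sum_image fun g _ g' _ h => List.ofFn_injective h]
  rw [h1, h2, Zbend_eq_sum_sawWords]
  -- pdW w ≤ [w ∈ sawWords] t^{wturns w}
  have h3 : ∑ w ∈ words (n + 1), pdW t w = ∑ w ∈ (words (n + 1)).filter IsPD, t ^ wturns w := by
    rw [Finset.sum_filter]
    rfl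
  rw [h3]
  refine Finset.sum_le_sum_of_subset_of_nonneg (fun w hw => ?_) fun w _ _ => by positivity
  rw [Finset.mem_filter] at hw
  exact mem_sawWords.2 ⟨mem_words.1 hw.1, hw.2.isSAW⟩

/-- **The partially directed lower bound**: `(1 + √2)·(1 + √2 t)^n ≤ Z_{n+1}(t)` for every `t ≥ 0` and `n`.
[cite: MadrasSlade1993, §2.1] -/
theorem one_add_sqrt_two_mul_pow_le_Zbend {t : ℝ} (ht : 0 ≤ t) (n : ℕ) :
    (1 + Real.sqrt 2) * (1 + Real.sqrt 2 * t) ^ n ≤ Zd.Zbend (n + 1) t := by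
  obtain ⟨hH, hV⟩ := pdT_lower ht n
  have h2 : 0 ≤ pdT t n 2 := Finset.sum_nonneg fun g _ => pdW_nonneg ht _
  calc (1 + Real.sqrt 2) * (1 + Real.sqrt 2 * t) ^ n
      = (1 + Real.sqrt 2 * t) ^ n + Real.sqrt 2 * (1 + Real.sqrt 2 * t) ^ n := by ring
    _ ≤ pdT t n 0 + (pdT t n 1 + pdT t n 3) + pdT t n 2 := by linarith
    _ = ∑ a : Step, pdT t n a := by rw [Fin.sum_univ_four]; ring
    _ ≤ Zd.Zbend (n + 1) t := sum_pdT_le_Zbend ht n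

/-! ### The targets: Props verbatim from the planner's `Sketch_v7.lean` / `Sketch_v7_add1.lean`, and their proofs -/

namespace Zd

/-- Finite-`N` form (pure counting): `(1 + √2 t)^{N-1} ≤ Z_N(t)`. Planner's Prop `Zbend_lower_sqrt2` verbatim.
[cite: MadrasSlade1993, §2.1] -/
def Zbend_lower_sqrt2 : Prop := ∀ (N : ℕ) (t : ℝ), 0 < t → 1 ≤ N → (1 + Real.sqrt 2 * t) ^ (N - 1) ≤ Zbend N t

/-- `κ(t) ≥ log(1 + √2 t)` for all `t > 0` (so `liminf κ(t)/t ≥ √2 = 2·(1/√2)`). Planner's Prop `BendFE_lower_sqrt2`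
verbatim. [cite: MadrasSlade1993, §2.1] -/
def BendFE_lower_sqrt2 : Prop := ∀ t : ℝ, 0 < t → Real.log (1 + Real.sqrt 2 * t) ≤ bendFE t

/-- S4 (lower side from a supermultiplicative sub-family): `κ(t) ≥ (2ρ₋ - δ) t` eventually as `t → 0⁺`, for a
certified `ρ₋`. Planner's predicate `StiffLimit_lower` verbatim. [cite: MadrasSlade1993, §2.1] -/
def StiffLimit_lower (ρlo : ℝ) : Prop :=
  ∀ δ > 0, ∀ᶠ t in 𝓝[>] (0 : ℝ), (2 * ρlo - δ) * t ≤ bendFE t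

/-- **`Zbend_lower_sqrt2` holds**: `(1 + √2 t)^{N-1} ≤ Z_N(t)` for `t > 0`, `N ≥ 1` (indeed with the factor `1 + √2`).
[cite: MadrasSlade1993, §2.1] -/
theorem Zbend_lower_sqrt2_holds : Zbend_lower_sqrt2 := by
  intro N t ht hN
  obtain ⟨n, rfl⟩ : ∃ n, N = n + 1 := ⟨N - 1, by omega⟩
  rw [Nat.add_sub_cancel]
  have h := one_add_sqrt_two_mul_pow_le_Zbend ht.le n
  have hpow : 0 ≤ (1 + Real.sqrt 2 * t) ^ n := by positivity
  have hs : 0 ≤ Real.sqrt 2 := Real.sqrt_nonneg 2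
  nlinarith

/-- `max(1,t) · Z_{N+1}(t) ≥ (1 + √2 t)^{N+1}` for every `N` and `t ≥ 0`: the factor `(1 + √2)·max(1,t)` dominates
`1 + √2 t`. [cite: MadrasSlade1993, §2.1] -/
theorem pow_le_max_mul_Zbend {t : ℝ} (ht : 0 ≤ t) (N : ℕ) :
    (1 + Real.sqrt 2 * t) ^ (N + 1) ≤ max 1 t * Zbend (N + 1) t := by
  have h := one_add_sqrt_two_mul_pow_le_Zbend ht N
  have hs : 0 ≤ Real.sqrt 2 := Real.sqrt_nonneg 2
  have hpow : 0 ≤ (1 + Real.sqrt 2 * t) ^ N := by positivity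
  have hkey : 1 + Real.sqrt 2 * t ≤ max 1 t * (1 + Real.sqrt 2) := by
    rcases le_or_gt t 1 with h1 | h1
    · rw [max_eq_left h1]; nlinarith
    · rw [max_eq_right h1.le]; nlinarith
  have hm : 0 ≤ max 1 t := le_trans zero_le_one (le_max_left 1 t)
  calc (1 + Real.sqrt 2 * t) ^ (N + 1) = (1 + Real.sqrt 2 * t) ^ N * (1 + Real.sqrt 2 * t) := pow_succ _ _
    _ ≤ (1 + Real.sqrt 2 * t) ^ N * (max 1 t * (1 + Real.sqrt 2)) := mul_le_mul_of_nonneg_left hkey hpow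
    _ = max 1 t * ((1 + Real.sqrt 2) * (1 + Real.sqrt 2 * t) ^ N) := by ring
    _ ≤ max 1 t * Zbend (N + 1) t := mul_le_mul_of_nonneg_left h hm

/-- **`BendFE_lower_sqrt2` holds**: `log(1 + √2 t) ≤ κ(t)` for every `t > 0` — EVERY term of the infimum defining
`κ` is at least `log(1 + √2 t)` (no Fekete limit needed). [cite: MadrasSlade1993, §2.1] -/
theorem BendFE_lower_sqrt2_holds : BendFE_lower_sqrt2 := by
  intro t ht
  refine le_ciInf fun N => ?_
  have hN : (0 : ℝ) < (N : ℝ) + 1 := by positivity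
  rw [le_div_iff₀ hN]
  have hb : 0 < 1 + Real.sqrt 2 * t := by positivity
  have h := pow_le_max_mul_Zbend ht.le N
  have hpos : 0 < (1 + Real.sqrt 2 * t) ^ (N + 1) := pow_pos hb _
  calc Real.log (1 + Real.sqrt 2 * t) * ((N : ℝ) + 1) = Real.log ((1 + Real.sqrt 2 * t) ^ (N + 1)) := by
        rw [Real.log_pow]; push_cast; ring
    _ ≤ Real.log (max 1 t * Zbend (N + 1) t) := Real.log_le_log hpos h

/-- **`StiffLimit_lower (1/√2)` holds** (spelling `ρ₋ = 1 / Real.sqrt 2`, so `2ρ₋ = √2`): for every `δ > 0`,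
`(√2 - δ) t ≤ κ(t)` for all small `t > 0` (`log(1+u) ≥ u/(1+u) ≥ u - u²`). [cite: MadrasSlade1993, §2.1] -/
theorem StiffLimit_lower_inv_sqrt_two : StiffLimit_lower (1 / Real.sqrt 2) := by
  intro δ hδ
  have hs0 : 0 < Real.sqrt 2 := Real.sqrt_pos.2 (by norm_num)
  have hs2 : Real.sqrt 2 * Real.sqrt 2 = 2 := Real.mul_self_sqrt (by norm_num)
  have h2 : 2 * (1 / Real.sqrt 2) = Real.sqrt 2 := by field_simp; linarith [hs2]
  rw [h2]
  have hmem : Set.Ioo (0 : ℝ) (δ / 2) ∈ 𝓝[>] (0 : ℝ) := Ioo_mem_nhdsGT (by positivity)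
  filter_upwards [hmem] with t ht
  obtain ⟨ht0, htδ⟩ := ht
  refine le_trans ?_ (BendFE_lower_sqrt2_holds t ht0)
  -- `(√2 - δ) t ≤ u - u² ≤ u/(1+u) ≤ log(1+u)`, `u = √2 t`
  set u := Real.sqrt 2 * t with hu
  have hu0 : 0 < u := by positivity
  have hlog : u / (1 + u) ≤ Real.log (1 + u) := by
    have := Real.one_sub_inv_le_log_of_pos (show 0 < 1 + u by positivity)
    have e : 1 - (1 + u)⁻¹ = u / (1 + u) := by field_simp; ring
    linarith [e]
  have hfrac : u - u ^ 2 ≤ u / (1 + u) := by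
    rw [le_div_iff₀ (by positivity)]; nlinarith
  have hlin : (Real.sqrt 2 - δ) * t ≤ u - u ^ 2 := by
    have e : u ^ 2 = 2 * t ^ 2 := by rw [hu, mul_pow, Real.sq_sqrt (by norm_num : (0 : ℝ) ≤ 2)]
    have hpos : 0 < t * (δ - 2 * t) := mul_pos ht0 (by linarith)
    rw [e, hu]
    nlinarith
  linarith

end Zd

end Literature.Probability.RandomPlanarGeometry.SAW
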